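import Summits.ResolutionOfSingularities.ResolutionOfSingularities.Theorems.NearExitContraction
import Summits.ResolutionOfSingularities.ResolutionOfSingularities.Theorems.VeryNearCutClasses

/-!
# NearExit (S6-W) — the weight ideals `W_l` of the twisted basis and the bridge to `qIdeal`

Node «NearExit» of `decomp-res-lens-2` (g33), see `NearExitTau.lean` and `NearExitContraction.lean`.

For a family `b : Fin (d+1) → R` and an index `j`, `wIdeal j b l` is the ideal of values `F(b)` of polynomials all of
whose monomials `X^β` have WEIGHT `wt β = |β| + Σ_{k≠j} β_k ≥ l` (`X_j` weighs `1`, `X_k (k ≠ j)` weighs `2`).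
With the twisted basis `b_j = c_j`, `b_k = c_k − ŵ_k c_j` (`ŵ_j = 1`) of `VeryNearCutClasses` this is the weight
filtration of the rational point `x′_ŵ`, and `W_l ⊆ qIdeal c ŵ l` (`wIdeal_le_qIdeal`).

API: `wIdeal` is antitone, closed under products of elements (`mul_mem_wIdeal`), `W_l ⊆ 𝔪^{⌈l/2⌉}` (`wIdeal_le_pow`),
`𝔪 ⊆ W₁`, `b_k ∈ W₂ (k ≠ j)`, `b_j ∈ W₁`; binomial estimate `(p + q)ⁿ − pⁿ ∈ W_{2n+1}` for `p ∈ W₂`, `q ∈ W₃`; and the contraction lemma restated: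
`σ g ∈ 𝔪_Lˡ ⇒ g ∈ W_l` (`mem_wIdeal_of_map_mem_pow`).

Sources: [CossartPiltant2008] proof of Prop. 4.2; [Hironaka1970] §1 (the weights `W′_w`).
-/

open IsLocalRing
open Literature.AlgebraicGeometry.Resolution
open MvPolynomial

namespace Summit.ResolutionOfSingularities.ResolutionOfSingularities.Theorems.NearExit

section Weight

variable {R : Type} [CommRing R] {d : ℕ} (j : Fin (d + 1)) (b : Fin (d + 1) → R)

/-- **The weight ideal `W_l`**: values at `b` of polynomials whose monomials have weight `|β| + Σ_{k≠j} β_k ≥ l`.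
DEFINITION (data: an `Ideal R`). [cite: Hironaka1970, §1] -/
def wIdeal (l : ℕ) : Ideal R where
  carrier := {g | ∃ F : MvPolynomial (Fin (d + 1)) R, eval b F = g ∧
    ∀ β ∈ F.support, l ≤ β.degree + (Finsupp.erase j β).degree}
  add_mem' := by
    classical
    rintro g g' ⟨F, hF, hFw⟩ ⟨F', hF', hF'w⟩
    refine ⟨F + F', by rw [map_add, hF, hF'], fun β hβ => ?_⟩
    rcases Finset.mem_union.mp (support_add hβ) with h | h
    exacts [hFw β h, hF'w β h]
  zero_mem' := ⟨0, map_zero _, fun β hβ => by simp at hβ⟩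
  smul_mem' := by
    rintro r g ⟨F, hF, hFw⟩
    exact ⟨r • F, by rw [smul_eval, hF, smul_eq_mul], fun β hβ => hFw β (support_smul hβ)⟩

/-- `W` is antitone. [this file] -/
theorem wIdeal_anti {l l' : ℕ} (h : l ≤ l') : wIdeal j b l' ≤ wIdeal j b l := by
  rintro g ⟨F, hF, hFw⟩
  exact ⟨F, hF, fun β hβ => le_trans h (hFw β hβ)⟩

/-- `W₀ = ⊤`. [this file] -/
theorem mem_wIdeal_zero (g : R) : g ∈ wIdeal j b 0 :=
  ⟨C g, eval_C g, fun _ _ => Nat.zero_le _⟩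

/-- `W` is multiplicative. [this file] -/
theorem mul_mem_wIdeal {a a' : ℕ} {g g' : R} (hg : g ∈ wIdeal j b a) (hg' : g' ∈ wIdeal j b a') :
    g * g' ∈ wIdeal j b (a + a') := by
  classical
  obtain ⟨F, hF, hFw⟩ := hg
  obtain ⟨F', hF', hF'w⟩ := hg'
  refine ⟨F * F', by rw [map_mul, hF, hF'], fun β hβ => ?_⟩
  obtain ⟨γ, hγ, γ', hγ', rfl⟩ := Finset.mem_add.mp (support_mul F F' hβ)
  have h1 := hFw γ hγ
  have h2 := hF'w γ' hγ'
  rw [map_add, Finsupp.erase_add, map_add]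
  omega

/-- Powers: `g ∈ W_a ⇒ g^m ∈ W_{ma}`. [this file] -/
theorem pow_mem_wIdeal {a : ℕ} {g : R} (hg : g ∈ wIdeal j b a) (m : ℕ) : g ^ m ∈ wIdeal j b (m * a) := by
  induction m with
  | zero => rw [pow_zero, zero_mul]; exact mem_wIdeal_zero j b 1
  | succ m ih =>
    rw [pow_succ, Nat.succ_mul]
    exact mul_mem_wIdeal j b ih hg

/-- `b_k ∈ W₂` for `k ≠ j`. [this file] -/
theorem b_mem_wIdeal_two {k : Fin (d + 1)} (hk : k ≠ j) : b k ∈ wIdeal j b 2 := by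
  refine ⟨X k, eval_X k, fun β hβ => ?_⟩
  have hβ' := support_monomial_subset hβ
  rw [Finset.mem_singleton] at hβ'
  subst hβ'
  rw [Finsupp.degree_single, Finsupp.erase_single_ne hk.symm, Finsupp.degree_single]

/-- `b_j ∈ W₁`. [this file] -/
theorem bj_mem_wIdeal_one : b j ∈ wIdeal j b 1 := by
  refine ⟨X j, eval_X j, fun β hβ => ?_⟩
  have hβ' := support_monomial_subset hβ
  rw [Finset.mem_singleton] at hβ'
  subst hβ'
  rw [Finsupp.degree_single]
  omega

/-- Every `b_k` lies in `W_1`. [this file] -/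
theorem b_mem_wIdeal_one (k : Fin (d + 1)) : b k ∈ wIdeal j b 1 := by
  by_cases hk : k = j
  · subst hk; exact bj_mem_wIdeal_one k b
  · exact wIdeal_anti j b (by norm_num) (b_mem_wIdeal_two j b hk)

/-- **Binomial estimate**: `p ∈ W₂`, `q ∈ W₃` ⇒ `(p + q)ⁿ − pⁿ ∈ W_{2n+1}`. [this file] -/
theorem add_pow_sub_pow_mem_wIdeal {p q : R} (hp : p ∈ wIdeal j b 2) (hq : q ∈ wIdeal j b 3) (n : ℕ) :
    (p + q) ^ n - p ^ n ∈ wIdeal j b (2 * n + 1) := by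
  induction n with
  | zero => simp
  | succ n ih =>
    have : (p + q) ^ (n + 1) - p ^ (n + 1) = (p + q) * ((p + q) ^ n - p ^ n) + q * p ^ n := by ring
    rw [this]
    refine Ideal.add_mem _ ?_ ?_
    · have hpq : p + q ∈ wIdeal j b 2 := Ideal.add_mem _ hp (wIdeal_anti j b (by norm_num) hq)
      have := mul_mem_wIdeal j b hpq ih
      exact wIdeal_anti j b (by omega) this
    · have := mul_mem_wIdeal j b hq (pow_mem_wIdeal j b hp n)
      exact wIdeal_anti j b (by omega) this

variable [IsLocalRing R]

/-- `𝔪 ⊆ W₁` when `b` generates `𝔪`. [this file] -/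
theorem maximalIdeal_le_wIdeal_one (hbm : Ideal.span (Set.range b) = maximalIdeal R) :
    maximalIdeal R ≤ wIdeal j b 1 := by
  rw [← hbm, Ideal.span_le]
  rintro _ ⟨k, rfl⟩
  exact b_mem_wIdeal_one j b k

/-- `|β| = β_j + |β off j|`. [folklore] -/
theorem degree_eq_add_erase (β : Fin (d + 1) →₀ ℕ) : β.degree = β j + (Finsupp.erase j β).degree := by
  rw [degree_eq_sum_univ, Fin.sum_univ_succAbove _ j, degree_erase_eq_sum]

/-- `W_l ⊆ 𝔪ᵐ` whenever `2m ≤ l + 1` (a monomial of weight `≥ l` has degree `≥ ⌈l/2⌉`). [this file] -/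
theorem wIdeal_le_pow (hbm : Ideal.span (Set.range b) = maximalIdeal R) {l m : ℕ} (h : 2 * m ≤ l + 1) :
    wIdeal j b l ≤ maximalIdeal R ^ m := by
  classical
  rintro g ⟨F, hF, hFw⟩
  rw [← hF, F.as_sum, map_sum]
  refine Ideal.sum_mem _ fun β hβ => ?_
  rw [eval_monomial, Finsupp.prod_pow]
  refine Ideal.mul_mem_left _ _ ?_
  have hwt := hFw β hβ
  have hdeg := degree_eq_add_erase j β
  have hm : m ≤ β.degree := by omega
  refine Ideal.pow_le_pow_right hm ?_
  rw [degree_eq_sum_univ, ← Finset.prod_pow_eq_pow_sum]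
  refine Ideal.prod_mem_prod fun k _ => Ideal.pow_mem_pow ?_ _
  rw [← hbm]; exact Ideal.subset_span ⟨k, rfl⟩

end Weight

section QBridge

variable {R : Type} [CommRing R] [IsLocalRing R] {d : ℕ}

/-- `𝔪ᵐ · 𝔫ʲ ⊆ Q(l)` for `l ≤ m + 2j`. [this file] -/
theorem pow_mul_pow_le_qIdeal (c w : Fin (d + 1) → R) {m i l : ℕ} (h : l ≤ m + 2 * i) :
    maximalIdeal R ^ m * VeryNearCutClasses.nIdeal c w ^ i ≤ VeryNearCutClasses.qIdeal c w l := by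
  unfold VeryNearCutClasses.qIdeal
  exact le_iSup_of_le m (le_iSup_of_le i (le_iSup_of_le h le_rfl))

/-- **`W_l ⊆ Q_ŵ(l)`** for the twisted basis `b_j = c_j`, `b_k = c_k − ŵ_k c_j` (`ŵ_j = 1`). [cite: Hironaka1970, §1] -/
theorem wIdeal_le_qIdeal (c ŵ : Fin (d + 1) → R) (j : Fin (d + 1)) (hŵj : ŵ j = 1)
    (hcj : c j ∈ maximalIdeal R) (l : ℕ) :
    wIdeal j (Function.update (fun k => c k - ŵ k * c j) j (c j)) l ≤ VeryNearCutClasses.qIdeal c ŵ l := by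
  classical
  set b : Fin (d + 1) → R := Function.update (fun k => c k - ŵ k * c j) j (c j) with hb
  rintro g ⟨F, hF, hFw⟩
  rw [← hF, F.as_sum, map_sum]
  refine Ideal.sum_mem _ fun β hβ => ?_
  rw [eval_monomial, Finsupp.prod_pow, Fin.prod_univ_succAbove _ j]
  refine Ideal.mul_mem_left _ _ ?_
  have hwt := hFw β hβ
  have hdeg := degree_eq_add_erase j β
  refine pow_mul_pow_le_qIdeal c ŵ (m := β j) (i := (Finsupp.erase j β).degree) (by omega) ?_
  refine Ideal.mul_mem_mul (Ideal.pow_mem_pow (by rw [hb, Function.update_self]; exact hcj) _) ?_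
  rw [degree_erase_eq_sum, ← Finset.prod_pow_eq_pow_sum]
  refine Ideal.prod_mem_prod fun i _ => Ideal.pow_mem_pow ?_ _
  rw [hb, Function.update_of_ne (Fin.succAbove_ne j i)]
  refine Ideal.mem_sup_left (Ideal.subset_span ⟨j, j.succAbove i, ?_⟩)
  rw [hŵj, one_mul]

end QBridge

section ContractionW

variable {R L : Type} [CommRing R] [IsLocalRing R] [CommRing L] [IsLocalRing L]
  (σ : R →+* L) {d : ℕ} (j : Fin (d + 1)) (b : Fin (d + 1) → R) (t : L) (y : Fin (d + 1) → L)
  (hbj : σ (b j) = t) (hbk : ∀ k, k ≠ j → σ (b k) = t * y k) (hrsop : IsRsopPart (Function.update y j t))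

include hbj hbk hrsop in
/-- **Contraction, ideal form**: `σ g ∈ 𝔪_Lˡ ⇒ g ∈ W_l`. [cite: CossartPiltant2008, §4] -/
theorem mem_wIdeal_of_map_mem_pow (hbm : Ideal.span (Set.range b) = maximalIdeal R) {l : ℕ} {g : R}
    (hg : σ g ∈ maximalIdeal L ^ l) : g ∈ wIdeal j b l := by
  obtain ⟨F', h1, h2⟩ := contraction σ j b t y hbj hbk hrsop hbm l (C g) (by rwa [eval_C])
  exact ⟨F', by rw [h1, eval_C], h2⟩

end ContractionW

end Summit.ResolutionOfSingularities.ResolutionOfSingularities.Theorems.NearExit
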